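import Literature.AlgebraicGeometry.HodgeTheory.HyperplaneClassRational
import HarnessLib

/-!
# `ι^* H²(ℙᴺ(ℂ); ℂ)` is the complex line through the hyperplane-type class (proved)

Family `hodge`, layer `Literature/AlgebraicGeometry/HodgeTheory`, companion of
`HyperplaneClassRational` (`exists_ne_zero_smul_isRationalClass_of_pullback_eq_fubiniStudy`: for
`X` smooth projective with a Hodge model `A`, a closed immersion `ι : X ⟶ ℙᴺ`, a natural real de Rham
family `e` and the class `H ∈ H²(X(ℂ); ℂ)` with `A^* H = e[θ_ι] ⊗ 1`, some non-zero complex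
multiple of `H` is rational). The proof there shows more, and this file EXPORTS it:

* `exists_map_eq_smul_of_pullback_eq_fubiniStudy` — **every class `ι^* a`, `a ∈ H²(ℙᴺ(ℂ); ℂ)`,
  is a complex multiple `s • H` of the hyperplane-type class, with `s ≠ 0` when `a ≠ 0` and
  `dim X ≥ 1`** (`H²(ℙᴺ(ℂ); ℂ) = ℂ r₀`, `ι^* c_{ℙᴺ} = r • H` by the naturality of the restricted
  Fubini–Study form and the rigidity of natural de Rham comparisons — steps (1)–(3) of the module
  docstring of `HyperplaneClassRational`, verbatim);
* `exists_real_map_eq_smul_of_pullback_eq_fubiniStudy` — **for a RATIONAL `a ≠ 0` the scalar is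
  REAL and non-zero**: `ι^* a` is rational, hence real (`IsRationalClass.conjClass_eq`), and `H` is
  real (a Kähler class, `IsKaehlerClassVia.conjClass_eq`) and non-zero, so `conj s = s`.

This is the reading of the polarization-type class `d · ι^* a + φ^* ι^* a` (`a` rational non-zero,
`Motives/HyperbolicWeilType`, `Motives/AimedSplitProduct`) as a real multiple of a Kähler class
(Voisin I §7.1.2: the Kähler class of a projective manifold may be taken rational, `[ω] = c₁(L)`).
No definition and no named fact is introduced (D-0026).

## References

* [VoisinHodgeI2002] C. Voisin, Hodge Theory and Complex Algebraic Geometry I (CUP 2002), §3.3.2,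
  §7.1.1, §7.1.2, Thm. 7.10, §7.3.2.
* [HatcherAT2002] A. Hatcher, Algebraic Topology (CUP 2002), Thm. 3.19, §3.1.
* [SerreGAGA1956] J.-P. Serre, GAGA, Ann. Inst. Fourier 6 (1956), §2 n°5.
-/

noncomputable section

open scoped Manifold ContDiff
open CategoryTheory AlgebraicGeometry

namespace Literature.AlgebraicGeometry.HodgeTheory

section HodgeTheory

open Literature.AlgebraicTopology.SingularHomology Literature.Geometry.Kaehler
open Literature.NumberTheory.Transcendental
open Literature.AlgebraicGeometry.Motives (projectiveSpace ComplexPoints IsSmoothProjective)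
open Literature.AlgebraicGeometry.Motives.AnalytificationKaehler (fubiniStudyPullbackForm)

variable {n : ℕ} {X : Motives.SchemeOver ℂ}

/-- `X^an` is compact for `X` smooth projective. Local copy of `HodgeModel.compactSpace_carrier`
(file `HypersurfaceHolomorphicForms`, not imported). [cite: SerreGAGA1956, §2 n°7 Prop. 6] -/
private theorem compactSpace_carrier₁ (A : HodgeModel n X) (hX : IsSmoothProjective n X) :
    CompactSpace A.carrier := by
  haveI : IsProper X.hom := Motives.IsSmoothProjective.isProper_holds hX
  haveI : CompactSpace (ComplexPoints X) := Motives.compactSpace_algPoints_of_isProper_holds X ℂ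
  exact A.isAnalytification.homeomorph.symm.compactSpace

/-- **`ι^* H²(ℙᴺ(ℂ); ℂ) ⊆ ℂ · H` for the hyperplane-type class `H`.** For `X` smooth projective of
dimension `n` with a Hodge model `A`, a closed immersion `ι : X ⟶ ℙᴺ`, a NATURAL real de Rham family
`e` and the class `H ∈ H²(X(ℂ); ℂ)` with `A^* H = e[θ_ι] ⊗ 1`: every `ι^* a`, `a ∈ H²(ℙᴺ(ℂ); ℂ)`, is
`s • H` for some `s ∈ ℂ`, and `s ≠ 0` if `a ≠ 0` and `n ≥ 1`. Proof: `H²(ℙᴺ(ℂ); ℂ) = ℂ · r₀`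
(`exists_isRationalClass_forall_eq_smul_projectiveSpace`); the Fubini–Study class `c_P` of `ℙᴺ`
satisfies `ι^* c_P = r • H` with `r ≠ 0` — `(ι^an)^* θ_{ℙᴺ} = θ_ι`
(`HodgeModel.fubiniStudyPullbackForm_pullback_anMap`), functoriality of the induced comparison
(`HodgeModel.inducedIso`) and rigidity of natural comparisons (`NaturalDeRhamComparisonRigidity_holds`)
— and `c_P = z₁ • r₀` with `z₁ ≠ 0`, so `ι^* r₀ = (r/z₁)… • H`. Verbatim the argument of
`exists_ne_zero_smul_isRationalClass_of_pullback_eq_fubiniStudy`.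
[cite: VoisinHodgeI2002, Thm. 7.10, §7.1.2 and §7.3.2] [cite: HatcherAT2002, Thm. 3.19] -/
theorem exists_map_eq_smul_of_pullback_eq_fubiniStudy (hX : IsSmoothProjective n X)
    (A : HodgeModel n X) {N : ℕ} (ι : X ⟶ projectiveSpace N ℂ) [IsClosedImmersion ι.left]
    (e : DeRhamIsoFamily 𝓘(ℝ, A.model)) (he : e.IsNatural)
    (hθ : fubiniStudyPullbackForm A.model ι A.toComplexPoints ∈ closedSmoothForms 𝓘(ℝ, A.model) A.carrier ℝ 2)
    {H : complexBetti X 2}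
    (hH : A.pullback 2 H = ofRealClass A.carrier 2 (e A.carrier 2
      (deRhamCohomology.mk ⟨fubiniStudyPullbackForm A.model ι A.toComplexPoints, hθ⟩)))
    (a : complexBetti (projectiveSpace N ℂ) 2) :
    ∃ s : ℂ, complexBetti.map ι 2 a = s • H ∧ (1 ≤ n → a ≠ 0 → s ≠ 0) := by
  -- dimension `0`: `H²(X(ℂ); ℂ) = 0`
  rcases Nat.eq_zero_or_pos n with rfl | hn
  · haveI : Subsingleton (complexBetti X 2) :=
      Motives.ComplexPoints.subsingleton_singularCohomology_of_lt hX ℂ (k := 2) (by omega)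
    exact ⟨0, Subsingleton.elim _ _, fun h ↦ absurd h (by omega)⟩
  -- the projective space, a Hodge model `B` of it with comparison `e_P ⊗ ℂ`
  have hP : IsSmoothProjective N (projectiveSpace N ℂ) := isSmoothProjective_projectiveSpace' N
  have hnN : n ≤ N := le_of_isClosedImmersion_projectiveSpace hX ι
  obtain ⟨B₀⟩ := (nonempty_hodgeModel_holds (n := N) (X := projectiveSpace N ℂ)).nonempty hP
  obtain ⟨eP, heP, -, -⟩ := exists_deRhamIsoFamily_holds B₀.model
  let B : HodgeModel N (projectiveSpace N ℂ) :=
    { B₀ with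
      deRham := eP.complexify
      deRham_isNatural := DeRhamIsoFamily.complexify_isNatural heP }
  -- the Fubini–Study class `c_P` of `ℙᴺ`
  haveI : IsClosedImmersion (𝟙 (projectiveSpace N ℂ) : projectiveSpace N ℂ ⟶ projectiveSpace N ℂ).left :=
    show IsClosedImmersion (𝟙 (projectiveSpace N ℂ).left) from inferInstance
  have hθP := B.fubiniStudyPullbackForm_mem_closedSmoothForms (𝟙 (projectiveSpace N ℂ))
  obtain ⟨cP, hcP⟩ := B.pullback_surjective 2 (ofRealClass B.carrier 2 (eP B.carrier 2
    (deRhamCohomology.mk ⟨fubiniStudyPullbackForm B.model (𝟙 (projectiveSpace N ℂ)) B.toComplexPoints, hθP⟩)))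
  -- (1) `c_P = z₁ • r₀`, `a = z • r₀`
  obtain ⟨r₀, -, hgen⟩ := exists_isRationalClass_forall_eq_smul_projectiveSpace N
  obtain ⟨z₁, hz₁⟩ := hgen cP
  obtain ⟨z, hz⟩ := hgen a
  set H₁ : complexBetti X 2 :=
    singularCohomology.map ℂ ℂ (Motives.AlgPoints.mapContinuous (L := ℂ) ι) 2 cP with hH₁def
  have hH₁ : H₁ = z₁ • singularCohomology.map ℂ ℂ (Motives.AlgPoints.mapContinuous (L := ℂ) ι) 2 r₀ := by
    rw [hH₁def, hz₁, map_smul]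
  -- (2) in the induced model: `A^* H₁ = e''[(ι^an)^* θ_P ⊗ 1]`
  have hfan : ContMDiff 𝓘(ℝ, A.model) 𝓘(ℝ, B.model) ∞ (HodgeModel.anMap B A ι) :=
    HodgeModel.contMDiff_anMap B A ι hX hP
  set wP : complexDeRhamCohomology B.model B.carrier 2 := complexDeRhamCohomology.ofReal B.model B.carrier 2
    (deRhamCohomology.mk ⟨fubiniStudyPullbackForm B.model (𝟙 (projectiveSpace N ℂ)) B.toComplexPoints, hθP⟩) with hwPdef
  have hwc : B.pullback 2 cP = B.deRham B.carrier 2 wP := by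
    rw [hcP, hwPdef]
    exact (complexifyFun_ofReal eP 2 _).symm
  have key : A.pullback 2 H₁ =
      HodgeModel.inducedIso B A hnN A.carrier 2 (complexDeRhamCohomology.map A.model hfan 2 wP) := by
    rw [HodgeModel.inducedIso_apply, ← LinearMap.comp_apply
        (g := complexDeRhamCohomology.map A.model hfan 2),
      ← complexDeRhamCohomology.map_comp hfan (contMDiff_cylFst B A hnN A.carrier),
      B.deRham_isNatural (Cyl B A hnN A.carrier) B.carrier _
        (hfan.comp (contMDiff_cylFst B A hnN A.carrier)) 2 wP,
      ← hwc, ← HodgeModel.map_anMap_pullback]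
    change _ = ((singularCohomology.map ℂ ℂ _ 2 ≫ singularCohomology.map ℂ ℂ _ 2).hom _)
    rw [← singularCohomology.map_comp]
    rfl
  -- the pulled-back form is `θ_ι`
  have hpull : (fubiniStudyPullbackForm B.model (𝟙 (projectiveSpace N ℂ)) B.toComplexPoints).pullback
      𝓘(ℝ, A.model) (HodgeModel.anMap B A ι) = fubiniStudyPullbackForm A.model ι A.toComplexPoints := by
    have h := A.fubiniStudyPullbackForm_pullback_anMap B ι (𝟙 (projectiveSpace N ℂ)) hX hP
    rwa [Category.comp_id] at h
  have hmap : complexDeRhamCohomology.map A.model hfan 2 wP =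
      complexDeRhamCohomology.ofReal A.model A.carrier 2
        (deRhamCohomology.mk ⟨fubiniStudyPullbackForm A.model ι A.toComplexPoints, hθ⟩) := by
    haveI : PullbackFacts 𝓘(ℝ, A.model) A.carrier 𝓘(ℝ, B.model) B.carrier ℝ := PullbackFacts.real_of_complex
    rw [hwPdef, ← complexDeRhamCohomology.ofReal_map, deRhamCohomology.map_mk]
    congr 2
    exact Subtype.ext hpull
  -- (3) rigidity: `e'' = r • (e ⊗ ℂ)` on `H²_dR(X^an; ℂ)`
  haveI : CompactSpace A.carrier := compactSpace_carrier₁ A hX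
  obtain ⟨r, hr⟩ := NaturalDeRhamComparisonRigidity_holds A.model A.model (HodgeModel.inducedFamily B A hnN)
    (HodgeModel.isNatural_inducedFamily B A hnN) e.complexify (DeRhamIsoFamily.complexify_isNatural he)
    A.carrier A.carrier (Homeomorph.refl A.carrier) contMDiff_id contMDiff_id 2
  have hr' : ∀ y : complexDeRhamCohomology A.model A.carrier 2,
      e.complexify A.carrier 2 y = r • HodgeModel.inducedIso B A hnN A.carrier 2 y := by
    intro y
    have h := hr y
    have h1 : (⟨Homeomorph.refl A.carrier, (Homeomorph.refl A.carrier).continuous⟩ : C(A.carrier, A.carrier)) =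
        ContinuousMap.id A.carrier := rfl
    have h2 : complexDeRhamCohomology.map A.model
        (contMDiff_id : ContMDiff 𝓘(ℝ, A.model) 𝓘(ℝ, A.model) ∞ (Homeomorph.refl A.carrier)) 2 =
          LinearMap.id :=
      complexDeRhamCohomology.map_id (E := A.model) (M := A.carrier) 2
    have lhs : singularCohomology.map ℂ ℂ
        (⟨Homeomorph.refl A.carrier, (Homeomorph.refl A.carrier).continuous⟩ : C(A.carrier, A.carrier)) 2
          (e.complexify A.carrier 2 y) = e.complexify A.carrier 2 y := by
      rw [h1, singularCohomology.map_id]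
      rfl
    have rhs : HodgeModel.inducedFamily B A hnN A.carrier 2 (complexDeRhamCohomology.map A.model
        (contMDiff_id : ContMDiff 𝓘(ℝ, A.model) 𝓘(ℝ, A.model) ∞ (Homeomorph.refl A.carrier)) 2 y) =
          HodgeModel.inducedIso B A hnN A.carrier 2 y :=
      congrArg (HodgeModel.inducedIso B A hnN A.carrier 2) (LinearMap.congr_fun h2 y)
    exact lhs.symm.trans (h.trans (congrArg (r • ·) rhs))
  -- `e ⊗ ℂ` of `θ_ι ⊗ 1` is `A^* H`
  have hHc : A.pullback 2 H = e.complexify A.carrier 2 (complexDeRhamCohomology.ofReal A.model A.carrier 2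
      (deRhamCohomology.mk ⟨fubiniStudyPullbackForm A.model ι A.toComplexPoints, hθ⟩)) := by
    rw [hH]
    exact (complexifyFun_ofReal e 2 _).symm
  -- hence `A^* H = r • A^* H₁`, `H = r • H₁ = (r z₁) • ι^* r₀`
  have hHH₁ : H = r • H₁ := by
    apply A.pullback_injective 2
    rw [map_smul, key, hmap, hHc, hr']
  -- `H ≠ 0` (a Kähler class), so `r ≠ 0` and `z₁ ≠ 0`
  have hK : A.IsKaehlerClassVia e H := A.isKaehlerClassVia_of_pullback_eq_fubiniStudyPullbackForm e hX ι hθ hH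
  have hH0 : H ≠ 0 := hK.ne_zero hX hn
  have hr0 : r ≠ 0 := by
    rintro rfl
    exact hH0 (by rw [hHH₁, zero_smul])
  have hz0 : z₁ ≠ 0 := by
    rintro rfl
    exact hH0 (by rw [hHH₁, hH₁, zero_smul, smul_zero])
  -- `ι^* r₀ = (r z₁)⁻¹ • H` and `ι^* a = z • ι^* r₀`
  have hr₀ : singularCohomology.map ℂ ℂ (Motives.AlgPoints.mapContinuous (L := ℂ) ι) 2 r₀ = (r * z₁)⁻¹ • H := by
    rw [hHH₁, hH₁, smul_smul, smul_smul, mul_assoc, inv_mul_cancel₀ (mul_ne_zero hr0 hz0), one_smul]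
  refine ⟨z * (r * z₁)⁻¹, ?_, fun _ ha0 ↦ ?_⟩
  · change singularCohomology.map ℂ ℂ (Motives.AlgPoints.mapContinuous (L := ℂ) ι) 2 a = _
    rw [hz, map_smul, hr₀, smul_smul]
  · have hz' : z ≠ 0 := by
      rintro rfl
      exact ha0 (by rw [hz, zero_smul])
    exact mul_ne_zero hz' (inv_ne_zero (mul_ne_zero hr0 hz0))

/-- **For a rational `a ≠ 0` the scalar is real and non-zero**: `ι^* a = s • H` with `s ∈ ℝ ∖ {0}`
(`dim X ≥ 1`). Both `ι^* a` (rational) and `H` (Kähler) are fixed by complex conjugation of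
coefficients (`IsRationalClass.conjClass_eq`, `IsKaehlerClassVia.conjClass_eq`) and `H ≠ 0`, so
`conj s = s`. [cite: VoisinHodgeI2002, §7.1.2 and Cor. 6.12] -/
theorem exists_real_map_eq_smul_of_pullback_eq_fubiniStudy (hX : IsSmoothProjective n X) (hn : 1 ≤ n)
    (A : HodgeModel n X) {N : ℕ} (ι : X ⟶ projectiveSpace N ℂ) [IsClosedImmersion ι.left]
    (e : DeRhamIsoFamily 𝓘(ℝ, A.model)) (he : e.IsNatural)
    (hθ : fubiniStudyPullbackForm A.model ι A.toComplexPoints ∈ closedSmoothForms 𝓘(ℝ, A.model) A.carrier ℝ 2)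
    {H : complexBetti X 2}
    (hH : A.pullback 2 H = ofRealClass A.carrier 2 (e A.carrier 2
      (deRhamCohomology.mk ⟨fubiniStudyPullbackForm A.model ι A.toComplexPoints, hθ⟩)))
    {a : complexBetti (projectiveSpace N ℂ) 2} (ha : IsRationalClass a) (ha0 : a ≠ 0) :
    ∃ s : ℝ, s ≠ 0 ∧ complexBetti.map ι 2 a = (s : ℂ) • H := by
  obtain ⟨s, hs, hs0⟩ := exists_map_eq_smul_of_pullback_eq_fubiniStudy hX A ι e he hθ hH a
  have hK : A.IsKaehlerClassVia e H := A.isKaehlerClassVia_of_pullback_eq_fubiniStudyPullbackForm e hX ι hθ hH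
  have hH0 : H ≠ 0 := hK.ne_zero hX hn
  -- `conj (ι^* a) = ι^* a` and `conj H = H`
  have hreal : conjClass (ComplexPoints X) 2 (complexBetti.map ι 2 a) = complexBetti.map ι 2 a :=
    (ha.pullback _).conjClass_eq
  rw [hs, conjClass_smul, hK.conjClass_eq] at hreal
  have hss : (starRingEnd ℂ) s = s := by
    have h := sub_eq_zero.2 hreal
    rw [← sub_smul, smul_eq_zero] at h
    exact sub_eq_zero.1 (h.resolve_right hH0)
  refine ⟨s.re, ?_, ?_⟩
  · intro h0
    apply hs0 hn ha0
    rw [← Complex.conj_eq_iff_re.1 hss, h0, Complex.ofReal_zero]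
  · rw [hs, ← Complex.conj_eq_iff_re.1 hss]
    rfl

end HodgeTheory

end Literature.AlgebraicGeometry.HodgeTheory

end
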